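import Summits.QuantumFields.YangMills.Theorems.PoincareLipschitzIteratedOfAvgStabilityModGauge
import Literature.MathematicalPhysics.QuantumFieldTheory.Balaban1983to89.B3Taylor310LocalRemainder
import HarnessLib

/-!
# Crux stmt-QuantumFields-19936 `UnitScaleTilt.HistoryTailL`, K2 at depth (route crux `PoincareLipschitz.BlockLipschitzL`, stmt-QuantumFields-23533),
# K2 supplier plan of record (card v1.27 (c)), file F5b-5a — THE READING SETS OF THE RE-GAUGED TOWER ON THE THREE-TORUS:
# `S_i = {b : |b₋·Lⁱ − a₀·L^{j+1}|₁ + 2L^{i+1} ≤ 8L^{j+1}}` is closed under the two-block (indeed three-block) neighbourhoods of the (0.4) average,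
# lies inside the crux's windows at every height and inside its `17L^{j+1}` box at height zero, and contains the footprints of `∂a` at the top

Cell `ym3-torus` (YM ladder rung R3 = continuum SU(2) Yang–Mills on the three-torus — a RUNG, NOT the Clay problem: not d = 4, not infinite
volume, not a mass gap); width seat `ym-ust-19936-w2` g10, pen F5 of the K2 supplier plan (LEAD `ym-ust-19936-w1` g7, 2026-08-29T00:35:51Z).
Helper `--supports stmt-QuantumFields-19936`; THEOREMS ONLY (0 `def`, 0 `sorry`); pure torus bookkeeping in the letters of the displayed row `hStab`
of ✓`PoincareLipschitzIteratedOfAvgStability` (scaled corners `x·Lⁱ` as level-zero sites, `Site.tdist`, the window `tdist + 64Lⁱ ≤ 64L^{j+1}`,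
the box `(b₋ − a₀L^{j+1} + 8L^{j+1}).val < 17L^{j+1}`).  Nothing here proves `hStab`, a stub, `BlockLipschitzL`, `HistoryTailL` or a summit statement.

WHY.  The tower ✓`PoincareLipschitzRegaugedTowerInduction.exists_regauge_top_sum_normSq_le` runs on an abstract family of bond sets `S_i` with
«two-block neighbourhood of a bond of `S_{i+1}` ⊆ `S_i`»; its `T3Family` packaging needs such a family around the plaquette `a` of `hStab`, with
`S_0` inside the box of the row's right side, every (0.4) loop of a bond of `S_{i+1}` inside the window at height `i` (so that the background's loop
variables are `≤ ((d+2)L)²/4·θBal(K−i)` by lit ✓`dist1_loopHol_le_local`), and the footprints of `∂a` inside `S_j`.  With the scaled-corner distance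
`D_i(x) := |x·Lⁱ − a₀·L^{j+1}|₁` (`Site.tdist` of level-zero sites, EXACTLY the window's letter) the choice `S_i := {D_i(b₋) + 2L^{i+1} ≤ 8L^{j+1}}`
works: one block costs `3(L−1)Lⁱ` (§2), one coarse step `L^{i+1}` (§2), and `6L^{i+1} − 3Lⁱ ≤ 2L^{i+2}` for `L ≥ 3` (§3).

WHAT IS PROVED (ns `…Theorems.PoincareLipschitzTowerReadingSets`; `F : T3Family`, `K`, heights in the standing range).
* §1 torus-distance letters on `ZMod N`: `tdist_comm`, `min_val_add_natCast_le` (a translate by `t` moves the circular distance by `≤ t`),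
  `val_add_natCast_le_of_min_le` (the box reading of a circular-distance bound).
* §2 `tdist_corner_blockOf_le` (`≤ 3(L−1)Lⁱ`), `corner_shift_apply`, `tdist_corner_shift_le` / `tdist_corner_unshift_le` (`≤ Lⁱ`).
* §3 ★ `readingSet_closed` (three-block neighbourhood of a bond of `S_{i+1}` ⊆ `S_i`, sites), ★ `window_of_readingSet` (`D_i + 64Lⁱ ≤ 64L^{j+1}` on `S_i`, `i ≤ j`),
  ★ `footprint_mem_readingSet` (the two-block footprints of the four bonds of `∂a` lie in `S_j`), ★ `box_of_readingSet_zero` (a bond of `S_0` and its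
  endpoint satisfy the row's box condition, `j + 3 ≤ K`).
HONEST SCOPE.  Arithmetic on `ZMod (2L^{m+K})`; nothing analytic.

References: T. Bałaban, CMP 109 (1987) 249–301 [Balaban1987RG1] ((0.1)–(0.4) pp.251–253); CMP 98 (1985) 17–51 [Balaban1985Averaging] ((5), (62) pp.18, 28).
-/

noncomputable section

namespace Summit.QuantumFields.YangMills.Theorems.PoincareLipschitzTowerReadingSets

open Literature.MathematicalPhysics.QuantumFieldTheory.Balaban1983to89
open Literature.MathematicalPhysics.QuantumFieldTheory.Balaban1983to89.T3ContinuumYM3Torus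
open T4Continuum
open Summit.QuantumFields.YangMills.Theorems.PoincareLipschitzIteratedOfAvgStability (sitesPerDir_zero_eq_mul_pow three_mul_pow_le_sitesPerDir_zero)
open B3Taylor310LocalRemainder (tdist_triangle)

/-! ## §1 Circular-distance letters on `ZMod N` -/

section ZModLetters

variable {N : ℕ} [NeZero N]

/-- A translate by a natural number `t` moves the circular distance by at most `t`:
`min (D+t).val (−(D+t)).val ≤ min D.val (−D).val + t`. [folklore] -/
theorem min_val_add_natCast_le (D : ZMod N) (t : ℕ) :
    min (D + (t : ZMod N)).val (-(D + (t : ZMod N))).val ≤ min D.val (-D).val + t := by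
  rw [← min_add_add_right]
  refine le_min ?_ ?_
  · -- `(D + t).val ≤ D.val + t`
    refine (min_le_left _ _).trans ?_
    calc (D + (t : ZMod N)).val ≤ D.val + (t : ZMod N).val := ZMod.val_add_le _ _
      _ ≤ D.val + t := by rw [ZMod.val_natCast]; exact Nat.add_le_add_left (Nat.mod_le _ _) _
  · -- against `(−D).val + t`
    by_cases ht : t ≤ (-D).val
    · refine (min_le_right _ _).trans ?_
      have e : -(D + (t : ZMod N)) = (((-D).val - t : ℕ) : ZMod N) := by
        rw [Nat.cast_sub ht, ZMod.natCast_zmod_val]; ring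
      rw [e, ZMod.val_natCast]
      exact (Nat.mod_le _ _).trans (by omega)
    · refine (min_le_left _ _).trans ?_
      rw [not_le] at ht
      have e : D + (t : ZMod N) = ((t - (-D).val : ℕ) : ZMod N) := by
        rw [Nat.cast_sub ht.le, ZMod.natCast_zmod_val]; ring
      rw [e, ZMod.val_natCast]
      exact (Nat.mod_le _ _).trans (by omega)

/-- **Box reading of a circular-distance bound**: if `min D.val (−D).val ≤ R ≤ c` then `(D + c).val ≤ R + c`. [folklore] -/
theorem val_add_natCast_le_of_min_le (D : ZMod N) {R c : ℕ} (h : min D.val (-D).val ≤ R) (hRc : R ≤ c) :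
    (D + (c : ZMod N)).val ≤ R + c := by
  by_cases hle : D.val ≤ (-D).val
  · rw [min_eq_left hle] at h
    have e : D + (c : ZMod N) = ((D.val + c : ℕ) : ZMod N) := by rw [Nat.cast_add, ZMod.natCast_zmod_val]
    rw [e, ZMod.val_natCast]
    exact (Nat.mod_le _ _).trans (by omega)
  · rw [not_le] at hle
    rw [min_eq_right hle.le] at h
    have hc : (-D).val ≤ c := h.trans hRc
    have e : D + (c : ZMod N) = ((c - (-D).val : ℕ) : ZMod N) := by
      rw [Nat.cast_sub hc, ZMod.natCast_zmod_val]; ring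
    rw [e, ZMod.val_natCast]
    exact (Nat.mod_le _ _).trans (by omega)

end ZModLetters

/-- `|x − x|₁ = 0`. [folklore] -/
theorem tdist_self' {P : Params} {j : ℕ} (x : Site P j) : Site.tdist x x = 0 := by
  unfold Site.tdist
  simp

/-- Symmetry of the `ℓ¹` torus distance. [folklore] -/
theorem tdist_comm {P : Params} {j : ℕ} (x y : Site P j) : Site.tdist x y = Site.tdist y x := by
  unfold Site.tdist
  exact Finset.sum_congr rfl fun μ _ => min_comm _ _

/-! ## §2 Scaled corners: one block, one coarse step -/

section Corners

variable (F : T3Family) (K : ℕ)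

/-- **ONE BLOCK**: the scaled corner of a level-`i` site is within `3(L−1)Lⁱ` of the scaled corner of its block (`x_k = L·(B x)_k + r_k`, `r_k < L`). [folklore] -/
theorem tdist_corner_blockOf_le {i : ℕ} (hi : i + 1 ≤ F.m + K) (x : Site (F.P K) i) :
    Site.tdist (fun k => ((((x k).val * F.L ^ i : ℕ)) : ZMod ((F.P K).sitesPerDir 0)))
        (fun k => (((((blockOf x) k).val * F.L ^ (i + 1) : ℕ)) : ZMod ((F.P K).sitesPerDir 0))) ≤ 3 * (F.L - 1) * F.L ^ i := by
  have hPL : (F.P K).L = F.L := rfl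
  have hd : (F.P K).d = 3 := rfl
  have hL0 : 0 < F.L := by have := F.hL.2; omega
  unfold Site.tdist
  calc _ ≤ ∑ _μ : Fin (F.P K).d, (F.L - 1) * F.L ^ i := by
        refine Finset.sum_le_sum fun k _ => (min_le_left _ _).trans ?_
        have hval : ((blockOf x) k).val = (x k).val / F.L := by rw [← hPL]; exact Site.val_blockOf hi x k
        set v := (x k).val with hv
        have hdec : v * F.L ^ i = (v / F.L) * F.L ^ (i + 1) + (v % F.L) * F.L ^ i := by
          have h1 : F.L * (v / F.L) + v % F.L = v := Nat.div_add_mod v F.L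
          calc v * F.L ^ i = (F.L * (v / F.L) + v % F.L) * F.L ^ i := by rw [h1]
            _ = (v / F.L) * F.L ^ (i + 1) + (v % F.L) * F.L ^ i := by rw [pow_succ]; ring
        have e : ((((v * F.L ^ i : ℕ)) : ZMod ((F.P K).sitesPerDir 0))) -
            ((((((blockOf x) k).val * F.L ^ (i + 1) : ℕ)) : ZMod ((F.P K).sitesPerDir 0))) =
            ((((v % F.L) * F.L ^ i : ℕ)) : ZMod ((F.P K).sitesPerDir 0)) := by
          rw [hval, hdec]; push_cast; ring
        rw [e, ZMod.val_natCast]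
        refine (Nat.mod_le _ _).trans (Nat.mul_le_mul_right _ ?_)
        have := Nat.mod_lt v hL0; omega
    _ = 3 * (F.L - 1) * F.L ^ i := by rw [Finset.sum_const, Finset.card_univ, Fintype.card_fin, hd, smul_eq_mul]; ring

/-- **ONE COARSE STEP, coordinatewise**: `corner_i (y + e_μ) = corner_i y + Lⁱ·e_μ` in `ZMod (2L^{m+K})` (exact, wrapping included: `N₀ = N_i·Lⁱ`). [folklore] -/
theorem corner_shift_apply {i : ℕ} (hi : i ≤ F.m + K) (y : Site (F.P K) i) (μ k : Fin (F.P K).d) :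
    ((((((y.shift μ) k).val * F.L ^ i : ℕ)) : ZMod ((F.P K).sitesPerDir 0))) =
      ((((y k).val * F.L ^ i : ℕ)) : ZMod ((F.P K).sitesPerDir 0)) + (if k = μ then (((F.L ^ i : ℕ)) : ZMod ((F.P K).sitesPerDir 0)) else 0) := by
  by_cases hk : k = μ
  · subst hk
    rw [if_pos rfl]
    have hs : (y.shift k) k = y k + 1 := by simp [Site.shift]
    set Ni := (F.P K).sitesPerDir i with hNi
    have hN0 : (F.P K).sitesPerDir 0 = Ni * F.L ^ i := sitesPerDir_zero_eq_mul_pow F K hi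
    have hNi2 : 2 ≤ Ni := by
      show 2 ≤ 2 * (F.P K).L ^ ((F.P K).m + (F.P K).K - i)
      have : 0 < (F.P K).L ^ ((F.P K).m + (F.P K).K - i) := pow_pos (F.P K).L_pos _
      omega
    haveI : NeZero Ni := ⟨by omega⟩
    have hval : ((y.shift k) k).val = ((y k).val + 1) % Ni := by
      rw [hs, ZMod.val_add, ZMod.val_one_eq_one_mod, Nat.add_mod_mod]
    rw [hval]
    -- `((v+1) % Ni)·Lⁱ ≡ (v+1)·Lⁱ (mod Ni·Lⁱ)`
    set v := (y k).val with hv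
    have hdm : (v + 1) = Ni * ((v + 1) / Ni) + (v + 1) % Ni := (Nat.div_add_mod _ _).symm
    have e : (((((v + 1) % Ni) * F.L ^ i : ℕ)) : ZMod ((F.P K).sitesPerDir 0)) = ((((v + 1) * F.L ^ i : ℕ)) : ZMod ((F.P K).sitesPerDir 0)) := by
      have h0 : (((Ni * F.L ^ i : ℕ)) : ZMod ((F.P K).sitesPerDir 0)) = 0 := by rw [← hN0]; exact ZMod.natCast_self _
      conv_rhs => rw [hdm]
      have : (Ni * ((v + 1) / Ni) + (v + 1) % Ni) * F.L ^ i = (Ni * F.L ^ i) * ((v + 1) / Ni) + ((v + 1) % Ni) * F.L ^ i := by ring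
      rw [this]; push_cast; rw [show (((Ni : ℕ)) : ZMod ((F.P K).sitesPerDir 0)) * (((F.L : ℕ)) : ZMod _) ^ i = (((Ni * F.L ^ i : ℕ)) : ZMod _) by push_cast; ring, h0]
      ring
    rw [e]; push_cast; ring
  · rw [if_neg hk, add_zero]
    have : (y.shift μ) k = y k := Function.update_of_ne hk _ _
    rw [this]

/-- **ONE COARSE STEP**: the scaled corners of `y + e_μ` and `y` are within `Lⁱ` in the `ℓ¹` torus distance. [folklore] -/
theorem tdist_corner_shift_le {i : ℕ} (hi : i ≤ F.m + K) (y : Site (F.P K) i) (μ : Fin (F.P K).d) :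
    Site.tdist (fun k => ((((((y.shift μ) k).val * F.L ^ i : ℕ)) : ZMod ((F.P K).sitesPerDir 0))))
        (fun k => ((((y k).val * F.L ^ i : ℕ)) : ZMod ((F.P K).sitesPerDir 0))) ≤ F.L ^ i := by
  unfold Site.tdist
  have e : ∀ k : Fin (F.P K).d, ((((((y.shift μ) k).val * F.L ^ i : ℕ)) : ZMod ((F.P K).sitesPerDir 0))) -
      ((((y k).val * F.L ^ i : ℕ)) : ZMod ((F.P K).sitesPerDir 0)) = if k = μ then (((F.L ^ i : ℕ)) : ZMod ((F.P K).sitesPerDir 0)) else 0 := by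
    intro k; rw [corner_shift_apply F K hi y μ k]; ring
  calc _ ≤ ∑ k : Fin (F.P K).d, (if k = μ then F.L ^ i else 0) := by
        refine Finset.sum_le_sum fun k _ => (min_le_left _ _).trans ?_
        rw [e k]
        by_cases hk : k = μ
        · rw [if_pos hk, if_pos hk, ZMod.val_natCast]; exact Nat.mod_le _ _
        · rw [if_neg hk, if_neg hk, ZMod.val_zero]
    _ = F.L ^ i := by rw [Finset.sum_ite_eq', if_pos (Finset.mem_univ _)]

/-- `(y − e_μ) + e_μ = y`. [folklore] -/
theorem shift_unshift {P : Params} {j : ℕ} (y : Site P j) (μ : Fin P.d) : (y.unshift μ).shift μ = y := by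
  funext k
  by_cases hk : k = μ
  · subst hk; simp [Site.shift, Site.unshift]
  · show Function.update (y.unshift μ) μ ((y.unshift μ) μ + 1) k = y k
    rw [Function.update_of_ne hk]
    exact Function.update_of_ne hk _ _

/-- **ONE COARSE STEP BACKWARDS**: the scaled corners of `y − e_μ` and `y` are within `Lⁱ`. [folklore] -/
theorem tdist_corner_unshift_le {i : ℕ} (hi : i ≤ F.m + K) (y : Site (F.P K) i) (μ : Fin (F.P K).d) :
    Site.tdist (fun k => ((((((y.unshift μ) k).val * F.L ^ i : ℕ)) : ZMod ((F.P K).sitesPerDir 0))))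
        (fun k => ((((y k).val * F.L ^ i : ℕ)) : ZMod ((F.P K).sitesPerDir 0))) ≤ F.L ^ i := by
  have h := tdist_corner_shift_le F K hi (y.unshift μ) μ
  rw [shift_unshift] at h
  rwa [tdist_comm]

end Corners

/-! ## §3 The reading sets `S_i = {D_i(b₋) + 2L^{i+1} ≤ 8L^{j+1}}` around a level-`(j+1)` plaquette `a` -/

section ReadingSets

variable (F : T3Family) (K : ℕ) {j : ℕ}

/-- ★ **CLOSURE**: if the level-`(i+1)` site `y` has `D_{i+1}(y) + 2L^{i+2} ≤ 8L^{j+1}` then every level-`i` site `x` whose block is `y − e_μ`, `y`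
or `y + e_μ` has `D_i(x) + 2L^{i+1} ≤ 8L^{j+1}` (one block `3(L−1)Lⁱ` + one step `L^{i+1}`, and `6L^{i+1} − 3Lⁱ ≤ 2L^{i+2}` for `L ≥ 3`). [folklore] -/
theorem readingSet_closed {i : ℕ} (hi : i + 1 ≤ F.m + K) (a₀ : Site (F.P K) (j + 1)) (y : Site (F.P K) (i + 1)) (μ : Fin (F.P K).d)
    (hy : Site.tdist (fun k => ((((y k).val * F.L ^ (i + 1) : ℕ)) : ZMod ((F.P K).sitesPerDir 0)))
        (fun k => ((((a₀ k).val * F.L ^ (j + 1) : ℕ)) : ZMod ((F.P K).sitesPerDir 0))) + 2 * F.L ^ (i + 2) ≤ 8 * F.L ^ (j + 1))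
    (x : Site (F.P K) i) (hx : blockOf x = y.unshift μ ∨ blockOf x = y ∨ blockOf x = y.shift μ) :
    Site.tdist (fun k => ((((x k).val * F.L ^ i : ℕ)) : ZMod ((F.P K).sitesPerDir 0)))
        (fun k => ((((a₀ k).val * F.L ^ (j + 1) : ℕ)) : ZMod ((F.P K).sitesPerDir 0))) + 2 * F.L ^ (i + 1) ≤ 8 * F.L ^ (j + 1) := by
  have hL3 : 3 ≤ F.L := (by obtain ⟨k, hk⟩ := F.hL.1; have := F.hL.2; omega)
  have hLi : 0 < F.L ^ i := pow_pos (by omega) i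
  -- block leg
  have h1 := tdist_corner_blockOf_le F K hi x
  -- step leg: the block of `x` versus `y`
  have h2 : Site.tdist (fun k => (((((blockOf x) k).val * F.L ^ (i + 1) : ℕ)) : ZMod ((F.P K).sitesPerDir 0)))
      (fun k => ((((y k).val * F.L ^ (i + 1) : ℕ)) : ZMod ((F.P K).sitesPerDir 0))) ≤ F.L ^ (i + 1) := by
    rcases hx with h | h | h
    · rw [h]; exact tdist_corner_unshift_le F K hi y μ
    · rw [h, tdist_self']; exact Nat.zero_le _
    · rw [h]; exact tdist_corner_shift_le F K hi y μ
  have h3 := tdist_triangle (fun k => ((((x k).val * F.L ^ i : ℕ)) : ZMod ((F.P K).sitesPerDir 0)))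
    (fun k => (((((blockOf x) k).val * F.L ^ (i + 1) : ℕ)) : ZMod ((F.P K).sitesPerDir 0)))
    (fun k => ((((a₀ k).val * F.L ^ (j + 1) : ℕ)) : ZMod ((F.P K).sitesPerDir 0)))
  have h4 := tdist_triangle (fun k => (((((blockOf x) k).val * F.L ^ (i + 1) : ℕ)) : ZMod ((F.P K).sitesPerDir 0)))
    (fun k => ((((y k).val * F.L ^ (i + 1) : ℕ)) : ZMod ((F.P K).sitesPerDir 0)))
    (fun k => ((((a₀ k).val * F.L ^ (j + 1) : ℕ)) : ZMod ((F.P K).sitesPerDir 0)))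
  -- arithmetic: `3(L−1)Lⁱ ≤ 3L^{i+1}` and `6L^{i+1} ≤ 2L^{i+2}` for `L ≥ 3`
  have h1' : Site.tdist (fun k => ((((x k).val * F.L ^ i : ℕ)) : ZMod ((F.P K).sitesPerDir 0)))
      (fun k => (((((blockOf x) k).val * F.L ^ (i + 1) : ℕ)) : ZMod ((F.P K).sitesPerDir 0))) ≤ 3 * F.L ^ (i + 1) := by
    refine h1.trans ?_
    calc 3 * (F.L - 1) * F.L ^ i ≤ 3 * F.L * F.L ^ i := Nat.mul_le_mul_right _ (Nat.mul_le_mul_left _ (Nat.sub_le _ _))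
      _ = 3 * F.L ^ (i + 1) := by rw [pow_succ]; ring
  have key : 6 * F.L ^ (i + 1) ≤ 2 * F.L ^ (i + 2) := by
    have hp : 0 < F.L ^ (i + 1) := pow_pos (by omega) _
    rw [show F.L ^ (i + 2) = F.L ^ (i + 1) * F.L by rw [pow_succ]]
    nlinarith
  omega

/-- ★ **WINDOW**: a level-`i` site with `D_i(x) + 2L^{i+1} ≤ 8L^{j+1}`, `i ≤ j`, satisfies the crux's window inequality `D_i(x) + 64Lⁱ ≤ 64L^{j+1}`. [folklore] -/
theorem window_of_readingSet {i : ℕ} (hij : i ≤ j) (a₀ : Site (F.P K) (j + 1)) (x : Site (F.P K) i)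
    (hx : Site.tdist (fun k => ((((x k).val * F.L ^ i : ℕ)) : ZMod ((F.P K).sitesPerDir 0)))
        (fun k => ((((a₀ k).val * F.L ^ (j + 1) : ℕ)) : ZMod ((F.P K).sitesPerDir 0))) + 2 * F.L ^ (i + 1) ≤ 8 * F.L ^ (j + 1)) :
    Site.tdist (fun k => ((((x k).val * F.L ^ i : ℕ)) : ZMod ((F.P K).sitesPerDir 0)))
        (fun k => ((((a₀ k).val * F.L ^ (j + 1) : ℕ)) : ZMod ((F.P K).sitesPerDir 0))) + 64 * F.L ^ i ≤ 64 * F.L ^ (j + 1) := by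
  have hL3 : 3 ≤ F.L := (by obtain ⟨k, hk⟩ := F.hL.1; have := F.hL.2; omega)
  have h1 : F.L ^ i ≤ F.L ^ j := Nat.pow_le_pow_right (by omega) hij
  have h2 : 3 * F.L ^ j ≤ F.L ^ (j + 1) := by rw [pow_succ]; nlinarith [pow_pos (show 0 < F.L by omega) j]
  omega

/-- A site obtained from `a₀` by at most two coarse steps is within `2L^{j+1}` of it (scaled corners). [folklore] -/
theorem tdist_corner_two_shifts_le (hj : j + 1 ≤ F.m + K) (a₀ : Site (F.P K) (j + 1)) (y : Site (F.P K) (j + 1))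
    (hy : y = a₀ ∨ (∃ μ, y = a₀.shift μ) ∨ (∃ μ ν, y = (a₀.shift μ).shift ν)) :
    Site.tdist (fun k => ((((y k).val * F.L ^ (j + 1) : ℕ)) : ZMod ((F.P K).sitesPerDir 0)))
        (fun k => ((((a₀ k).val * F.L ^ (j + 1) : ℕ)) : ZMod ((F.P K).sitesPerDir 0))) ≤ 2 * F.L ^ (j + 1) := by
  rcases hy with rfl | ⟨μ, rfl⟩ | ⟨μ, ν, rfl⟩
  · rw [tdist_self']; exact Nat.zero_le _
  · exact (tdist_corner_shift_le F K hj a₀ μ).trans (by omega)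
  · have h1 := tdist_corner_shift_le F K hj (a₀.shift μ) ν
    have h2 := tdist_corner_shift_le F K hj a₀ μ
    have h3 := tdist_triangle (fun k => ((((((a₀.shift μ).shift ν) k).val * F.L ^ (j + 1) : ℕ)) : ZMod ((F.P K).sitesPerDir 0)))
      (fun k => (((((a₀.shift μ) k).val * F.L ^ (j + 1) : ℕ)) : ZMod ((F.P K).sitesPerDir 0)))
      (fun k => ((((a₀ k).val * F.L ^ (j + 1) : ℕ)) : ZMod ((F.P K).sitesPerDir 0)))
    omega

/-- ★ **FOOTPRINTS**: for each of the four bonds `c₀` of `∂a` and each level-`j` bond `b` with `blockOf b₋ ∈ {c₀₋, c₀₊}`, `D_j(b₋) + 2L^{j+1} ≤ 8L^{j+1}`. [folklore] -/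
theorem footprint_mem_readingSet (hj : j + 1 ≤ F.m + K) (a : Plaq (F.P K) (j + 1)) (c₀ : PBond (F.P K) (j + 1))
    (hc₀ : c₀ = ⟨a.src, a.μ⟩ ∨ c₀ = ⟨a.src.shift a.μ, a.ν⟩ ∨ c₀ = ⟨a.src.shift a.ν, a.μ⟩ ∨ c₀ = ⟨a.src, a.ν⟩)
    (b : PBond (F.P K) j) (hb : blockOf b.src = c₀.src ∨ blockOf b.src = c₀.tgt) :
    Site.tdist (fun k => ((((b.src k).val * F.L ^ j : ℕ)) : ZMod ((F.P K).sitesPerDir 0)))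
        (fun k => ((((a.src k).val * F.L ^ (j + 1) : ℕ)) : ZMod ((F.P K).sitesPerDir 0))) + 2 * F.L ^ (j + 1) ≤ 8 * F.L ^ (j + 1) := by
  have hL3 : 3 ≤ F.L := (by obtain ⟨k, hk⟩ := F.hL.1; have := F.hL.2; omega)
  have h1 := tdist_corner_blockOf_le F K hj b.src
  -- the block of `b₋` is `a₀` moved by at most two coarse steps
  have hy : blockOf b.src = a.src ∨ (∃ μ, blockOf b.src = a.src.shift μ) ∨ (∃ μ ν, blockOf b.src = (a.src.shift μ).shift ν) := by
    rcases hc₀ with rfl | rfl | rfl | rfl <;> rcases hb with h | h <;> simp only [PBond.tgt] at h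
    · exact Or.inl h
    · exact Or.inr (Or.inl ⟨_, h⟩)
    · exact Or.inr (Or.inl ⟨_, h⟩)
    · exact Or.inr (Or.inr ⟨_, _, h⟩)
    · exact Or.inr (Or.inl ⟨_, h⟩)
    · exact Or.inr (Or.inr ⟨_, _, h⟩)
    · exact Or.inl h
    · exact Or.inr (Or.inl ⟨_, h⟩)
  have h2 := tdist_corner_two_shifts_le F K hj a.src (blockOf b.src) hy
  have h3 := tdist_triangle (fun k => ((((b.src k).val * F.L ^ j : ℕ)) : ZMod ((F.P K).sitesPerDir 0)))
    (fun k => (((((blockOf b.src) k).val * F.L ^ (j + 1) : ℕ)) : ZMod ((F.P K).sitesPerDir 0)))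
    (fun k => ((((a.src k).val * F.L ^ (j + 1) : ℕ)) : ZMod ((F.P K).sitesPerDir 0)))
  have e1 : F.L ^ (j + 1) = F.L * F.L ^ j := by rw [pow_succ]; ring
  have h4 : 3 * (F.L - 1) * F.L ^ j ≤ 3 * F.L ^ (j + 1) := by
    rw [e1]
    calc 3 * (F.L - 1) * F.L ^ j ≤ 3 * F.L * F.L ^ j := Nat.mul_le_mul_right _ (Nat.mul_le_mul_left _ (Nat.sub_le _ _))
      _ = 3 * (F.L * F.L ^ j) := by ring
  omega

/-- At height zero the scaled corner is the site itself. [folklore] -/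
theorem corner_zero_apply (x : Site (F.P K) 0) (k : Fin (F.P K).d) :
    ((((x k).val * F.L ^ 0 : ℕ)) : ZMod ((F.P K).sitesPerDir 0)) = x k := by
  rw [pow_zero, mul_one, ZMod.natCast_zmod_val]

/-- ★ **BOX**: a level-zero bond `b` with `D_0(b₋) + 2L ≤ 8L^{j+1}` satisfies the row's box condition at both endpoints:
`(b∓_k − a₀_k·L^{j+1} + 8L^{j+1}).val < 17L^{j+1}` for every `k`. [folklore] -/
theorem box_of_readingSet_zero (a₀ : Site (F.P K) (j + 1)) (b : PBond (F.P K) 0)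
    (hb : Site.tdist (fun k => ((((b.src k).val * F.L ^ 0 : ℕ)) : ZMod ((F.P K).sitesPerDir 0)))
        (fun k => ((((a₀ k).val * F.L ^ (j + 1) : ℕ)) : ZMod ((F.P K).sitesPerDir 0))) + 2 * F.L ^ (0 + 1) ≤ 8 * F.L ^ (j + 1)) :
    (∀ k, (b.src k - ((((a₀ k).val * F.L ^ (j + 1) : ℕ)) : ZMod ((F.P K).sitesPerDir 0)) +
        (((8 * F.L ^ (j + 1) : ℕ)) : ZMod ((F.P K).sitesPerDir 0))).val < 17 * F.L ^ (j + 1)) ∧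
    (∀ k, (b.tgt k - ((((a₀ k).val * F.L ^ (j + 1) : ℕ)) : ZMod ((F.P K).sitesPerDir 0)) +
        (((8 * F.L ^ (j + 1) : ℕ)) : ZMod ((F.P K).sitesPerDir 0))).val < 17 * F.L ^ (j + 1)) := by
  have hL3 : 3 ≤ F.L := (by obtain ⟨k, hk⟩ := F.hL.1; have := F.hL.2; omega)
  have hLj : F.L ≤ F.L ^ (j + 1) := by
    calc F.L = F.L ^ 1 := (pow_one _).symm
      _ ≤ F.L ^ (j + 1) := Nat.pow_le_pow_right (by omega) (by omega)
  rw [zero_add, pow_one] at hb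
  -- per coordinate circular distance of `b₋` to the corner
  have hcoord : ∀ k, min (b.src k - ((((a₀ k).val * F.L ^ (j + 1) : ℕ)) : ZMod ((F.P K).sitesPerDir 0))).val
      (-(b.src k - ((((a₀ k).val * F.L ^ (j + 1) : ℕ)) : ZMod ((F.P K).sitesPerDir 0)))).val + 2 * F.L ≤ 8 * F.L ^ (j + 1) := by
    intro k
    have hk := Finset.single_le_sum (s := Finset.univ) (f := fun μ : Fin (F.P K).d =>
        min ((fun k => ((((b.src k).val * F.L ^ 0 : ℕ)) : ZMod ((F.P K).sitesPerDir 0))) μ -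
              (fun k => ((((a₀ k).val * F.L ^ (j + 1) : ℕ)) : ZMod ((F.P K).sitesPerDir 0))) μ).val
            ((fun k => ((((a₀ k).val * F.L ^ (j + 1) : ℕ)) : ZMod ((F.P K).sitesPerDir 0))) μ -
              (fun k => ((((b.src k).val * F.L ^ 0 : ℕ)) : ZMod ((F.P K).sitesPerDir 0))) μ).val)
      (fun _ _ => Nat.zero_le _) (Finset.mem_univ k)
    simp only [corner_zero_apply] at hk
    rw [neg_sub]
    unfold Site.tdist at hb
    simp only [corner_zero_apply] at hb
    exact le_trans (Nat.add_le_add_right hk _) hb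
  refine ⟨fun k => ?_, fun k => ?_⟩
  · have h := val_add_natCast_le_of_min_le (b.src k - ((((a₀ k).val * F.L ^ (j + 1) : ℕ)) : ZMod ((F.P K).sitesPerDir 0)))
      (R := 8 * F.L ^ (j + 1) - 2 * F.L) (c := 8 * F.L ^ (j + 1)) (by have := hcoord k; omega) (Nat.sub_le _ _)
    omega
  · -- `b₊ = b₋ + e_dir`: the circular distance moves by at most one
    have hshift : ∀ k, b.tgt k = b.src k + (if k = b.dir then 1 else 0) := by
      intro k
      show (b.src.shift b.dir) k = _
      by_cases hk : k = b.dir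
      · subst hk; simp [Site.shift]
      · rw [if_neg hk, add_zero]
        exact Function.update_of_ne hk _ _
    have hD : min (b.tgt k - ((((a₀ k).val * F.L ^ (j + 1) : ℕ)) : ZMod ((F.P K).sitesPerDir 0))).val
        (-(b.tgt k - ((((a₀ k).val * F.L ^ (j + 1) : ℕ)) : ZMod ((F.P K).sitesPerDir 0)))).val ≤ 8 * F.L ^ (j + 1) - 2 * F.L + 1 := by
      have e : b.tgt k - ((((a₀ k).val * F.L ^ (j + 1) : ℕ)) : ZMod ((F.P K).sitesPerDir 0)) =
          (b.src k - ((((a₀ k).val * F.L ^ (j + 1) : ℕ)) : ZMod ((F.P K).sitesPerDir 0))) +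
            (((if k = b.dir then 1 else 0 : ℕ)) : ZMod ((F.P K).sitesPerDir 0)) := by
        rw [hshift k]; split_ifs <;> push_cast <;> ring
      rw [e]
      refine (min_val_add_natCast_le _ _).trans ?_
      have h8 := hcoord k
      have h1 : (if k = b.dir then 1 else 0 : ℕ) ≤ 1 := by split_ifs <;> omega
      omega
    have h := val_add_natCast_le_of_min_le (b.tgt k - ((((a₀ k).val * F.L ^ (j + 1) : ℕ)) : ZMod ((F.P K).sitesPerDir 0)))
      (R := 8 * F.L ^ (j + 1) - 2 * F.L + 1) (c := 8 * F.L ^ (j + 1)) hD (by omega)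
    omega

end ReadingSets

end Summit.QuantumFields.YangMills.Theorems.PoincareLipschitzTowerReadingSets

end
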